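import Literature.AnabelianGeometry.EtaleTheta.ThetaProperFractionPairSmallIndex
import Literature.AnabelianGeometry.EtaleTheta.Discharge.Sec5ThetaZerosPullInvariantThetaTwistTowerSmallIndex
import Literature.AnabelianGeometry.EtaleTheta.Discharge.Sec5JunctionSmallIndexHypotheses
import Literature.AnabelianGeometry.EtaleTheta.Discharge.Sec5RootDivisorInvariance
import Literature.AnabelianGeometry.EtaleTheta.Discharge.Sec5RootDivisorInvarianceOfKernel
import HarnessLib

/-!
# [EtTh] §5 p.330 / Prop. 4.3 (i) at the junction carrier of record (small index): the junction binder `hθ` DISCHARGED for the theta function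
# `Θ̈` PROPER over every translation-free covering — in particular at the anchors of `settingSmall`/`settingSmallYdd` — and `hinvc` for every root datum

S. Mochizuki, *The étale theta function …*, Publ. RIMS **45** (2009) [MochizukiEtTh2009], §5 p.330 (PDF p.104) («the zero divisor `Div(s^⊓_N)` …
descends»), Prop. 4.3 (i) proof p.317 (PDF p.91) («it suffices to observe that `Div(s′)`, `Div(s″)` are fixed by `H`»), Def. 4.1 (ii) p.313 (PDF
p.87).  [cite: MochizukiEtTh2009, §5 p.330 (PDF p.104)]  PAGE CONVENTION for [EtTh]: «printed N (PDF p.M)», N = M + 226.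

PROOF-ONLY (theorems only; abc-iut cell, layer L2, seat abc-iut-L2-d2 gen 8; plan/L2/SUBDAG-EtTh-JUNCTION.md slots D5/D6a AT abc-iut-L2-t3's junction
carrier of record `temperedFrobenioidSmall` / `settingSmall` / `settingSmallYdd`; FILE D3 over D1/D2).  Consumed BY NAME, nothing restated:
D2 (`thetaProperNum`, `thetaZerosΦSmall`, `ιΦSmall`, `thetaProperUnitQuot`, `thetaProperFractionPairQuot`), abc-iut-L2-t11's small-index
zero-divisor invariance `pull_divisorMonoid_thetaZeros_small` (p502908), abc-iut-L2-t3's `isDivisorial_small` (p504077), `settingSmall` /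
`settingSmall_galoisSurjNatural` (p501267), abc-iut-L2-t4's `hinvc_of_thetaDivisor` (`Sec5RootDivisorInvariance`).
* **`pull_div_thetaProperNum`** — `Div(s′) = ι(zeros^{N_m})` is FIXED by pull-back along EVERY endomorphism of the covering `A` (the `N_m`-th power
  of L2-t11's statement);
* **`hθ_thetaProperNum`** — the junction binder `hθ` HOLDS for the theta function's fraction-pair in `settingSmall R S X φ hφ NH M` for EVERY open
  normal `M ≤ Ker φ₃` (anchor `(Compat₃′/M, 0)`) — at `settingSmallYdd` (M := `yddImage`) the hypothesis IS the display clause «`φ₃ ∘ φ ∘ ιX = 1`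
  on `Π^tp_Ÿ`»;
* **`hinvp_thetaProper`** — `hinvp` for every nested root datum from abc-iut-L2-t3's `hinvp_of_hH` (`hH : ιX(Π^tp_Ÿ) ⊆ H_⊙` only);
* **`hinvc_thetaProper`** — `hinvc` (`Φ(g)(Div s^⊓_N) = Div s^⊓_N`, all `g ∈ Aut_D(A_N^bs)`) for EVERY nested root datum `(Rl, R)` over `Θ̈` and EVERY
  transport datum `pullFrac`, with NO further hypothesis (`Φ` divisorial ⟸ `isDivisorial_small`; outer naturality ⟸ `settingSmall_galoisSurjNatural`).
HONEST FRAMING: class-(b) combinatorial DESIGN carrier (NOT the tempered Frobenioid of a Tate curve); onto-socket design-only (R1257); the roots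
themselves need a Prop. 4.2 (iii) instance at the small-index model (none in the tree) — `hinvc` is stated for whatever root data are supplied;
nothing here bears on [IUTchIII] Cor. 3.12; no side taken; typed ≠ proved.
-/

noncomputable section

namespace Literature.AnabelianGeometry.EtaleTheta

open CategoryTheory Opposite Function Literature.AlgebraicGeometry.Frobenioids Literature.AlgebraicGeometry.Frobenioids.QuasiTemperoid
  Literature.AnabelianGeometry.SemiGraphs LogDivisorModel LogDivisorModel.GaloisAction LogDivisorTower TateTowerKummerTwistRShear
  LogDivisorModel.TateTowerThetaTwist

namespace ThetaTwistTowerSmallIndex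

open ThetaTwistTowerTempered
open TateTowerKummerTwist (N)

variable (R S : ((ConnectedPart (BTemp (Compat 3 thetaShear)))ᵒᵖ ⥤ CommMonCat.{0}) → Prop) (A : ConnectedPart (BTemp (Compat 3 thetaShear)))
  (hA : ∀ (s : (gset (repr A)).V) (g : Compat 3 thetaShear), (gset (repr A)).ρ g s = s → φ₃ g = 1)

/-- **`Div(s′) = ι(zeros^{N_m})` is FIXED by pull-back along EVERY endomorphism of `A`** (the `N_m`-th power of abc-iut-L2-t11's
`pull_divisorMonoid_thetaZeros_small`). [cite: MochizukiEtTh2009, §5 p.330 (PDF p.104)] -/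
theorem pull_div_thetaProperNum (g : A ⟶ A) :
    pull (temperedFrobenioidSmall R S).divisorMonoid g (ModelFrobenioid.div (thetaProperNum R S A hA)) =
      ModelFrobenioid.div (thetaProperNum R S A hA) := by
  have e1 : ιΦSmall R S A (thetaZerosPowΦ₀ A) =
      ιΦSmall R S A (thetaZerosFamOf (gset (repr A)) (lvlC 3 thetaShear (repr A))) ^ ((N (lvlC 3 thetaShear (repr A)) : ℕ+) : ℕ) :=
    map_pow _ _ _
  have L : pull (temperedFrobenioidSmall R S).divisorMonoid g (ιΦSmall R S A (thetaZerosFamOf (gset (repr A)) (lvlC 3 thetaShear (repr A)))) =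
      ιΦSmall R S A (thetaZerosFamOf (gset (repr A)) (lvlC 3 thetaShear (repr A))) :=
    pull_divisorMonoid_thetaZeros_small R S g
  change pull (temperedFrobenioidSmall R S).divisorMonoid g (ιΦSmall R S A (thetaZerosPowΦ₀ A)) = ιΦSmall R S A (thetaZerosPowΦ₀ A)
  exact (congrArg (pull (temperedFrobenioidSmall R S).divisorMonoid g) e1).trans
    (((pull (temperedFrobenioidSmall R S).divisorMonoid g).map_pow _ _).trans
      ((congrArg (· ^ ((N (lvlC 3 thetaShear (repr A)) : ℕ+) : ℕ)) L).trans e1.symm))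

variable {K : Type} [Field K] (X : SemiGraphs.TemperedArithmeticGroup.{0} K)
  (NH : Subgroup (Field.absoluteGaloisGroup K) → (temperedFrobenioidSmall R S).category → ℕ+ → Prop) (φ : X.Pi →ₜ* Compat 3 thetaShear)
  (hφ : Function.Surjective φ) (M : OpenNormalSubgroup (Compat 3 thetaShear)) (hM : ∀ g ∈ M.toSubgroup, φ₃ g = 1)

/-- **The §5 junction binder `hθ` HOLDS for the theta function `Θ̈` in abc-iut-L2-t3's `settingSmall R S X φ hφ NH M`, for EVERY open normal
`M ≤ Ker φ₃`**: `Φ(ρ_{A_⊙}(x))(Div s′) = Div s′` for all `x ∈ Π^tp_X`.  At `M := yddImage …` (`settingSmallYdd`) the hypothesis `hM` is the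
display clause «`φ₃ ∘ φ ∘ ιX = 1` on `Π^tp_Ÿ`». [cite: MochizukiEtTh2009, §5 p.330 (PDF p.104); Prop 4.3 (i) p.317 (PDF p.91)] -/
theorem hθ_thetaProperNum (x : X.Pi) :
    pull (temperedFrobenioidSmall R S).divisorMonoid
        ((settingSmall R S X φ hφ NH M).galoisSurj ((temperedFrobenioidSmall R S).quotConnZeroObj isTempered_compat₃' M).base
          ((temperedFrobenioidSmall R S).isGaloisObj_quotConnZeroObj_base isTempered_compat₃' M) x).hom
        (ModelFrobenioid.div (thetaProperFractionPairQuot R S X NH φ hφ M hM).num) =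
      ModelFrobenioid.div (thetaProperFractionPairQuot R S X NH φ hφ M hM).num :=
  pull_div_thetaProperNum R S _ _ _

/-- **`hinvc` for EVERY nested root datum `A_⊙ ← A_l ← A_N` over the theta function in `settingSmall R S X φ hφ NH M`, `M ≤ Ker φ₃`**
(abc-iut-L2-t4's `hinvc_of_thetaDivisor`: `Φ` divisorial ⟸ abc-iut-L2-t3's `isDivisorial_small`; outer naturality ⟸ `settingSmall_galoisSurjNatural`;
`hθ` ⟸ `hθ_thetaProperNum`; ANY transport datum `pullFrac`): `Φ(g)(Div s^⊓_N) = Div s^⊓_N` for all `g ∈ Aut_D(A_N^bs)`.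
[cite: MochizukiEtTh2009, §5 p.330 (PDF p.104); Prop 4.3 (i) p.317 (PDF p.91)] -/
theorem hinvc_thetaProper
    {pullFrac : ∀ {B B' : (settingSmall R S X φ hφ NH M).C} (_ : B' ⟶ B),
      (settingSmall R S X φ hφ NH M).biratUnits B → (settingSmall R S X φ hφ NH M).biratUnits B'}
    {lv N' : ℕ+}
    (Rl : (settingSmall R S X φ hφ NH M).NthRoot (thetaProperUnitQuot R S M hM) (thetaProperFractionPairQuot R S X NH φ hφ M hM) lv pullFrac)
    (Rt : (settingSmall R S X φ hφ NH M).NthRoot Rl.root Rl.pair N' pullFrac) (g : Aut Rt.AN.base) :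
    pull (temperedFrobenioidSmall R S).divisorMonoid g.hom (ModelFrobenioid.div Rt.pair.num) = ModelFrobenioid.div Rt.pair.num :=
  ThetaFrobenioid.hinvc_of_thetaDivisor Rt (fun W => isDivisorial_small R S W) (settingSmall_galoisSurjNatural R S X φ hφ NH M)
    (hθ_thetaProperNum R S X NH φ hφ M hM) g


/-- **`hinvp` for every nested root datum over the theta function in `settingSmall R S X φ hφ NH M`** — from abc-iut-L2-t3's
`ThetaFrobenioid.hinvp_of_hH` (p.317 read as printed: `H_⊙` acts trivially on `A_⊙^bs`; NO hypothesis on the polar divisor), given only the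
§5 binder `hH : ιX(Π^tp_Ÿ) ⊆ H_⊙ = φ⁻¹(M)` (a THEOREM at the Ÿ-anchor `M := yddImage …`, `hH_settingSmallYdd`).  Recorded next to `hinvc`
so that BOTH divisor binders of `ofQuotientTemperoidData` are theorems at the theta datum of the carrier of record.
[cite: MochizukiEtTh2009, Prop 4.3 (i) p.317 (PDF p.91); §5 p.331 (PDF p.105)] -/
theorem hinvp_thetaProper
    {pullFrac : ∀ {B B' : (settingSmall R S X φ hφ NH M).C} (_ : B' ⟶ B),
      (settingSmall R S X φ hφ NH M).biratUnits B → (settingSmall R S X φ hφ NH M).biratUnits B'}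
    {lv N' : ℕ+} {T : ThetaEnvData.{0} N'} (ιX : T.PiX ≃ₜ* X.Pi)
    (hH : ∀ y : T.PiX, y ∈ T.PiYdd → ιX y ∈ (settingSmall R S X φ hφ NH M).Hodot)
    (Rl : (settingSmall R S X φ hφ NH M).NthRoot (thetaProperUnitQuot R S M hM) (thetaProperFractionPairQuot R S X NH φ hφ M hM) lv pullFrac)
    (Rt : (settingSmall R S X φ hφ NH M).NthRoot Rl.root Rl.pair N' pullFrac) (y : T.PiX) (hy : y ∈ T.PiYdd) :
    pull (temperedFrobenioidSmall R S).divisorMonoid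
        ((settingSmall R S X φ hφ NH M).galoisSurj Rt.AN.base Rt.αData.isGalois (ιX y)).hom (ModelFrobenioid.div Rt.pair.den) =
      ModelFrobenioid.div Rt.pair.den :=
  ThetaFrobenioid.hinvp_of_hH Rt ιX (fun W => isDivisorial_small R S W) (settingSmall_galoisSurjNatural R S X φ hφ NH M) hH y hy

end ThetaTwistTowerSmallIndex

end Literature.AnabelianGeometry.EtaleTheta

end
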